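import Literature.NumberTheory.NumberFields.HilbertClassFieldCopyCapitulation
import Literature.NumberTheory.GaloisRepresentations.RestrictedRamificationUnramifiedSubfields
import Literature.NumberTheory.GaloisRepresentations.IdeleClassGroupLimit
import HarnessLib

/-!
# Every layer `E ⊆ K_S` has a capitulating layer `M ⊇ E` inside `K_S`: a copy of the Hilbert class field in `K̄`
# (NSW (8.3.11), proof: «`Cl_S(k_S) = 0`» by the principal ideal theorem; Neukirch VI (7.5))

Topic `NumberTheory/GaloisRepresentations`; namespace `Literature.NumberTheory.GaloisRepresentations`.  THEOREMS ONLY (no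
definition, no named fact, no `sorry`, no instance).  Brick (A3c-3b) — the PLACEMENT — of lane «PT3-TC» of cell `bsd-eis`
(crux 2 `GoodLatticeBDPValue`, stmt-BirchSwinnertonDyer-19032; lane owner bsd-line-x1-p1-w8 g9, road memo `PT3TC-ROAD.md`,
ORDER OF WORK 2026-08-28T22:59:07Z, RULING 23:08:35Z (α): layers = `IdeleClassBar.GalLayer K` with `N_S ≤ Gal(K̄/E)`; this
brick by width seat -w6 g8), over (A3c-2) `RestrictedRamificationUnramifiedSubfields` and (A3c-3a)
`HilbertClassFieldCopyCapitulation`.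

MATHEMATICS.  Let `K` be a number field, `S` a set of finite places, `K̄ = AlgebraicClosure K`, `N_S ≤ Γ_K` the
ramification subgroup (`K_S = K̄^{N_S}`).  For a finite Galois `E ⊆ K̄` over `K` inside `K_S` (`N_S ≤ Gal(K̄/E)`), choose an
`E`-isomorphism `φ : Ē ≅ K̄` of algebraic closures (`IsAlgClosure.equiv`; `K̄` is an algebraic closure of `E`) and put
`M := φ(H(E)) ⊆ K̄`, an `E`-isomorphic copy of the Hilbert class field `H(E) ⊆ Ē`.  Then `M ⊇ E` is finite Galois over `K`
(`H(E)/K` is: Washington, proof of 10.4), unramified over `E` at every finite place, hence `M ⊆ K_S`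
(`ramificationSubgroup_le_fixingSubgroup_of_tower`), and every idèle of `E` capitulates in `M`:
`con_{M/E} x ∈ Mˣ · 𝕌_M ⊆ Mˣ · J_{M,S}` (principal ideal theorem, read through `[(con x)_f] = i_{M|E}[(x_f)]`).  This is the
step «`Cl_S(k_S) = lim→ Cl_S(L) = 0`» of NSW's proof of (8.3.11): the `S`-ideal classes of a layer die in a bigger layer of
`k_S`.

* `exists_capitulationLayer` — for `E : IntermediateField K K̄`, finite Galois over `K`, `N_S ≤ E.fixingSubgroup`:
  `∃ M ≥ E` finite Galois over `K` with `N_S ≤ M.fixingSubgroup` and, for the `E`-algebra structure of the inclusion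
  (`(IntermediateField.inclusion h).toRingHom.toAlgebra` = the tree's `IdeleClassBar.GalLayer.algebraOfLE`), two
  readings of capitulation: `Units.map (con) x ∈ principalIdeles M ⊔ unitIdeles M`, `… ⊔ IdeleCohomology.ideleS F M T`
  (any base `F` of `M`, any finite `T`), and the (A3d) shape `∃ u j, ideleBaseChange E M x = principal M u * j`;
* `exists_capitulationGalLayer` — the same in the lane's currency `IdeleClassBar.GalLayer K` / `algebraOfLE`.

HONEST FRAMING: plumbing over landed theorems (principal ideal theorem, conorm of idèles vs ideals, `K_S` dictionary);
no statement of any Summit is proved; BSD is not advanced by this file.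

## References
* J. Neukirch, A. Schmidt, K. Wingberg, *Cohomology of Number Fields*, 2nd ed. (2008), VIII §3, proof of (8.3.11)
  (`Cl_S(k_S) = 0` via the principal ideal theorem). [NeukirchSchmidtWingberg2008]
* J. Neukirch, *Algebraic Number Theory* (1999), Ch. VI §7 Thm. (7.5). [NeukirchANT1999]
* L. C. Washington, *Introduction to Cyclotomic Fields*, 2nd ed. (1997), Thm. 10.4 (proof). [Washington1997]
-/

noncomputable section

open NumberField IsDedekindDomain Field

namespace Literature.NumberTheory.GaloisRepresentations

open Literature.NumberTheory.NumberFields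

variable {K : Type} [Field K] [NumberField K] {S : Set (HeightOneSpectrum (𝓞 K))}

/-! ## §1. The capitulating layer inside `K_S` -/

/-- **Every finite Galois layer `E ⊆ K_S` has a capitulating finite Galois layer `M ⊇ E` inside `K_S`** (a copy in `K̄`
of the Hilbert class field of `E`): `M/K` finite Galois, `N_S ≤ Gal(K̄/M)`, and — for the inclusion algebra `E → M` —
every idèle of `E` becomes principal-times-unit in `M`: `con_{M/E} x ∈ Mˣ · 𝕌_M`, hence `∈ Mˣ · J_{M,T}` for every base
`F` of `M` and every finite `T` (Tate's `S`-idèles), and in the (A3d) shape `ideleBaseChange E M x = principal M u * j`.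
This is «`Cl_S(k_S) = 0`» of NSW's proof of (8.3.11), one layer at a time.
[cite: NeukirchSchmidtWingberg2008, VIII §3 (proof of (8.3.11))] [cite: NeukirchANT1999, Ch. VI §7 Thm. (7.5)]
[cite: Washington1997, Thm. 10.4 (proof)] -/
theorem exists_capitulationLayer (E : IntermediateField K (AlgebraicClosure K)) [FiniteDimensional K E] [IsGalois K E]
    (hE : ramificationSubgroup K S ≤ E.fixingSubgroup) :
    ∃ (M : IntermediateField K (AlgebraicClosure K)) (h : E ≤ M) (_ : FiniteDimensional K M) (_ : IsGalois K M),
      ramificationSubgroup K S ≤ M.fixingSubgroup ∧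
      (letI : Algebra E M := (IntermediateField.inclusion h).toRingHom.toAlgebra
       letI : NumberField E := NumberField.of_module_finite K E
       letI : NumberField M := NumberField.of_module_finite K M
       (∀ x : ideleGroup E, Units.map (NumberField.AdeleRing.baseChange E M :
          AdeleRing (𝓞 E) E →* AdeleRing (𝓞 M) M) x ∈ principalIdeles M ⊔ unitIdeles M) ∧
       (∀ (F : Type) [Field F] [NumberField F] [Algebra F M] (T : Finset (HeightOneSpectrum (𝓞 F)))
          (x : ideleGroup E), ∃ u : (M)ˣ, ∃ j ∈ IdeleCohomology.ideleS F M T,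
            Literature.NumberTheory.Automorphic.AdeleRing.ideleBaseChange E M x = IdeleHerbrand.principal M u * j)) := by
  haveI : NumberField E := NumberField.of_module_finite K E
  -- `K̄` is an algebraic closure of `E`; choose an `E`-isomorphism `φ : Ē ≅ K̄`
  haveI : IsAlgClosure E (AlgebraicClosure K) := { isAlgClosed := inferInstance, isAlgebraic := inferInstance }
  let φ : AlgebraicClosure E ≃ₐ[E] AlgebraicClosure K := IsAlgClosure.equiv E (AlgebraicClosure E) (AlgebraicClosure K)
  -- the copy `M := φ(H(E)) ⊆ K̄`, as a `K`-intermediate field containing `E`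
  let M : IntermediateField K (AlgebraicClosure K) := ((hilbertClassField E).map φ.toAlgHom).restrictScalars K
  have hmemM : ∀ z : AlgebraicClosure K, z ∈ M ↔ z ∈ (hilbertClassField E).map φ.toAlgHom := fun z => Iff.rfl
  have h : E ≤ M := by
    intro x hx
    rw [hmemM]
    exact IntermediateField.algebraMap_mem _ (⟨x, hx⟩ : E)
  letI algEM : Algebra E M := (IntermediateField.inclusion h).toRingHom.toAlgebra
  haveI : IsScalarTower K E M := IsScalarTower.of_algebraMap_eq fun _ => rfl
  -- the `E`-isomorphism `H(E) ≅ M` for the inclusion algebra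
  have hmem : ∀ y : hilbertClassField E, φ (y : AlgebraicClosure E) ∈ M := fun y => by
    rw [hmemM, IntermediateField.mem_map]
    exact ⟨y, y.2, rfl⟩
  let f : hilbertClassField E →ₐ[E] M :=
    { toFun := fun y => ⟨φ y, hmem y⟩
      map_one' := Subtype.ext (by simp)
      map_mul' := fun a b => Subtype.ext (by simp)
      map_zero' := Subtype.ext (by simp)
      map_add' := fun a b => Subtype.ext (by simp)
      commutes' := fun a => Subtype.ext (by
        change φ (algebraMap E (AlgebraicClosure E) a) = ((a : E) : AlgebraicClosure K)
        rw [AlgEquiv.commutes]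
        rfl) }
  have hf : Function.Bijective f := by
    refine ⟨fun a b hab => ?_, fun z => ?_⟩
    · have hab' := congrArg (fun t : M => (t : AlgebraicClosure K)) hab
      exact Subtype.ext (φ.injective hab')
    · have hz : (z : AlgebraicClosure K) ∈ (hilbertClassField E).map φ.toAlgHom := (hmemM z).mp z.2
      rw [IntermediateField.mem_map] at hz
      obtain ⟨y, hy, hyz⟩ := hz
      exact ⟨⟨y, hy⟩, Subtype.ext hyz⟩
  let e : hilbertClassField E ≃ₐ[E] M := AlgEquiv.ofBijective f hf
  haveI hfinEM : FiniteDimensional E M := hilbertClassField.finiteDimensional_of_algEquiv E M e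
  haveI hfin : FiniteDimensional K M := FiniteDimensional.trans K E M
  haveI : NumberField M := NumberField.of_module_finite K M
  haveI hgal : IsGalois K M := hilbertClassField.isGalois_of_algEquiv E M e K
  have hM : ramificationSubgroup K S ≤ M.fixingSubgroup :=
    ramificationSubgroup_le_fixingSubgroup_of_tower E M hE fun w =>
      hilbertClassField.isUnramifiedIn_of_algEquiv E M e w
  refine ⟨M, h, hfin, hgal, hM, fun x => ?_, fun F _ _ _ T x => ?_⟩
  · exact hilbertClassField.baseChange_mem_principalIdeles_sup_unitIdeles_of_algEquiv E M e x
  · exact hilbertClassField.exists_principal_mul_ideleS_eq_ideleBaseChange_of_algEquiv E M e F T x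

/-! ## §2. In the lane's currency: `IdeleClassBar.GalLayer K` and `algebraOfLE` -/

/-- **Capitulating layers in the currency of the tree's Galois layer systems** (`IdeleClassBar.GalLayer K`, towers by
`GalLayer.algebraOfLE`): every layer `E` with `N_S ≤ Gal(K̄/E)` has a layer `M ≥ E` with `N_S ≤ Gal(K̄/M)` in which every
idèle of `E` is principal-times-unit, in the two readings of `exists_capitulationLayer`.
[cite: NeukirchSchmidtWingberg2008, VIII §3 (proof of (8.3.11))] [cite: NeukirchANT1999, Ch. VI §7 Thm. (7.5)] -/
theorem exists_capitulationGalLayer (E : IdeleClassBar.GalLayer K)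
    (hE : ramificationSubgroup K S ≤ E.1.fixingSubgroup) :
    ∃ (M : IdeleClassBar.GalLayer K) (h : E ≤ M), ramificationSubgroup K S ≤ M.1.fixingSubgroup ∧
      (letI := IdeleClassBar.GalLayer.algebraOfLE h
       haveI := E.numberField
       haveI := M.numberField
       (∀ x : ideleGroup E.1, Units.map (NumberField.AdeleRing.baseChange E.1 M.1 :
          AdeleRing (𝓞 E.1) E.1 →* AdeleRing (𝓞 M.1) M.1) x ∈ principalIdeles M.1 ⊔ unitIdeles M.1) ∧
       (∀ (F : Type) [Field F] [NumberField F] [Algebra F M.1] (T : Finset (HeightOneSpectrum (𝓞 F)))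
          (x : ideleGroup E.1), ∃ u : (M.1)ˣ, ∃ j ∈ IdeleCohomology.ideleS F M.1 T,
            Literature.NumberTheory.Automorphic.AdeleRing.ideleBaseChange E.1 M.1 x =
              IdeleHerbrand.principal M.1 u * j)) := by
  haveI := E.finiteDimensional
  haveI := E.isGalois
  obtain ⟨M, h, hfin, hgal, hM, hcap, hcap'⟩ := exists_capitulationLayer (S := S) E.1 hE
  exact ⟨⟨M, hfin, hgal⟩, h, hM, hcap, hcap'⟩


/-! ## §3. The membership reading `ideleBaseChange E M x ∈ Mˣ · J_{M,T}` (the (A3d) part-2 hypothesis shape) -/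

/-- From the factorised reading to the membership reading: `con x = (u) · j` with `j ∈ J_{M,T}` gives
`con x ∈ Mˣ · J_{M,T}` (principal idèles are the range of `principal`). [cite: NeukirchANT1999, Ch. VI §1 Def. (1.2) (principal idèles)] -/
theorem ideleBaseChange_mem_principalIdeles_sup_ideleS_of_exists {E M F : Type} [Field E] [NumberField E]
    [Field M] [NumberField M] [Algebra E M] [Field F] [NumberField F] [Algebra F M]
    {T : Finset (HeightOneSpectrum (𝓞 F))} {x : ideleGroup E}
    (h : ∃ u : Mˣ, ∃ j ∈ IdeleCohomology.ideleS F M T,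
      Literature.NumberTheory.Automorphic.AdeleRing.ideleBaseChange E M x = IdeleHerbrand.principal M u * j) :
    Literature.NumberTheory.Automorphic.AdeleRing.ideleBaseChange E M x ∈
      principalIdeles M ⊔ IdeleCohomology.ideleS F M T := by
  obtain ⟨u, j, hj, hx⟩ := h
  rw [hx]
  exact Subgroup.mul_mem_sup ⟨u, rfl⟩ hj

/-- **Capitulating layers, MEMBERSHIP reading in the lane's currency** (the hypothesis `hcap` of the finite-layer
NSW (8.3.11) chase as typed by width seat -w7 g8, `IdeleSUnitsLayerChaseTwo.exists_smul_eq_inf_inf_sUnits_two`): every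
layer `E` of `K_S` (`IdeleClassBar.GalLayer K`, `N_S ≤ Gal(K̄/E)`) has a layer `M ≥ E` inside `K_S` such that, along
`GalLayer.algebraOfLE`, `ideleBaseChange E M a ∈ principalIdeles M ⊔ ideleS F M T` for every idèle `a` of `E`, every
base number field `F` of `M` and every finite `T`. [cite: NeukirchSchmidtWingberg2008, VIII §3 (proof of (8.3.11))]
[cite: NeukirchANT1999, Ch. VI §7 Thm. (7.5)] -/
theorem exists_capitulationGalLayer_mem (E : IdeleClassBar.GalLayer K)
    (hE : ramificationSubgroup K S ≤ E.1.fixingSubgroup) :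
    ∃ (M : IdeleClassBar.GalLayer K) (h : E ≤ M), ramificationSubgroup K S ≤ M.1.fixingSubgroup ∧
      (letI := IdeleClassBar.GalLayer.algebraOfLE h
       haveI := E.numberField
       haveI := M.numberField
       ∀ (F : Type) [Field F] [NumberField F] [Algebra F M.1] (T : Finset (HeightOneSpectrum (𝓞 F)))
          (a : ideleGroup E.1),
            Literature.NumberTheory.Automorphic.AdeleRing.ideleBaseChange E.1 M.1 a ∈
              principalIdeles M.1 ⊔ IdeleCohomology.ideleS F M.1 T) := by
  obtain ⟨M, h, hM, -, hcap'⟩ := exists_capitulationGalLayer (S := S) E hE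
  refine ⟨M, h, hM, ?_⟩
  letI := IdeleClassBar.GalLayer.algebraOfLE h
  haveI := E.numberField
  haveI := M.numberField
  intro F _ _ _ T a
  exact ideleBaseChange_mem_principalIdeles_sup_ideleS_of_exists (hcap' F T a)

end Literature.NumberTheory.GaloisRepresentations

end
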